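import Mathlib
import Literature.NumberTheory.LFunctions.RamanujanDivisorSquare
import HarnessLib

/-!
# Zhang (2022), §3: the Euler factors behind Lemma 3.1, Lemma 3.2 and the four-factor variant

Trunk T-ANT (NumberTheory/LFunctions). Y. Zhang, *Discrete mean estimates and the Landau–Siegel
zero*, arXiv:2211.02515v1 (2022) [Zhang2022LandauSiegel], §3, Lemmas 3.1–3.2 (p. 7 of the
source). **Status of the source: an unrefereed manuscript, a claimed result under adjudication**
(audit + repair census of arXiv:2211.02515; no claim about Landau–Siegel is made here).

THE PRINTED CLAIMS. With `χ` the real primitive character modulo `D`, `ν = 1 * χ`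
(`ζ(s)L(s,χ) = ∑ ν(n)n⁻ˢ`, p. 7 l. 3–7) and `τ₂` the divisor function, the proof of Lemma 3.1 puts
"`φ(s) = ζ(s)⁻²L(s,χ)⁻² ∑ₙ ν(n)²/nˢ`, which has the Euler product representation `φ(s) = ∏ₚ φₚ(s)`
(`σ > 1`). For `σ ≥ σ₀ > 0`, by checking the cases `χ(p) = ±1` and `χ(p) = 0` respectively, it can
be seen that `φₚ(s) = 1 + O(p^{-2σ})` if `p ∤ D`, and `φₚ(s) = (1 - p⁻ˢ)(1 + O(p^{-2σ}))` if
`p ∣ D` … Thus `φ(s)` is analytic for `σ > 1/2`" [p. 7, l. 21–41], and the sketched proof of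
Lemma 3.2 asserts "It can be verified that the function `φ*(s) = ζ(s)⁻⁸L(s,χ)⁻⁸ ∑ₙ ν(n)²τ₂(n)²/nˢ`
is analytic for `σ > 1/2` and it satisfies `φ*(s) ≪ ∏_{p∣D} |1 - p^{-4s}|`" [p. 7, l. 83–96].
The NUMBER OF `L`-FACTORS (`2`, resp. `8`) is what the contour shift of these lemmas has to beat
(`Section3SubconvexInput.Saves k a μ : 2kμ < a` with `k = 2`, resp. `k = 8`; the cell's
input-free variant "Lemma 3.2♭" for `ν²τ₂` has `k = 4`). This file COMPUTES the local factors —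
"checking the cases `χ(p) = 1, -1, 0`" — as formal power series identities in `z = p⁻ˢ`,
`‖z‖ < 1`, with `ν(pᵐ) = 1 + w + ⋯ + wᵐ = geomPartialSum w m` for `w = χ(p)`
(`RamanujanDivisorSquare.divisorSumChar_prime_pow`) and `τ₂(pᵐ) = m + 1`:

* `ν²` (Lemma 3.1): split `∑(m+1)²zᵐ = (1-z²)·(1-z)⁻⁴`, inert `(1-z²)·(1-z)⁻²(1+z)⁻²`, ramified
  `(1-z)·(1-z)⁻²` — i.e. `φₚ = 1 - p^{-2s}` (`p ∤ D`) and `φₚ = 1 - p⁻ˢ` (`p ∣ D`), EXACTLY, which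
  is the printed `1 + O(p^{-2σ})` / `(1-p⁻ˢ)(1+O(p^{-2σ}))` (`hasSum_nu_sq_split|inert|ramified`;
  the global identity `∑ν²n⁻ˢ · L(2s,χ²) = ζ(s)L(s,χ²)L(s,χ)²` is
  `LSeries_divisorSumChar_sq_mul_LSeries` of the imported file);
* `ν²τ₂` (four factors, the cell's Lemma 3.2♭ / Edison family A11): split
  `∑(m+1)³zᵐ = (1+4z+z²)(1-z)⁻⁴ = (1 - 9z² + 16z³ - 9z⁴ + z⁶)·(1-z)⁻⁸`, inert
  `(1 - z² - z⁴ + z⁶)·(1-z)⁻⁴(1+z)⁻⁴`, ramified `(1-z)²·(1-z)⁻⁴`: the generating function is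
  `ζ⁴L⁴φ♭` with `φ♭ₚ = 1 + O(p^{-2σ})` off `D` (`‖φ♭ₚ - 1‖ ≤ 35‖z‖²`) and `φ♭ₚ = (1-p⁻ˢ)²` on `D`;
* `ν²τ₂²` (eight factors, printed Lemma 3.2): split
  `∑(m+1)⁴zᵐ = (1+11z+11z²+z³)(1-z)⁻⁵ = [(1+11z+11z²+z³)(1-z)¹¹]·(1-z)⁻¹⁶`, inert
  `[(1+6z²+z⁴)(1-z²)⁵]·(1-z)⁻⁸(1+z)⁻⁸`, ramified `[(1+z)(1-z)⁵]·(1-z)⁻⁸`: the generating function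
  is `ζ⁸L⁸φ*` with `φ*ₚ = 1 + O(p^{-2σ})` off `D` (`‖φ*ₚ - 1‖ ≤ 7659‖z‖²`, the linear term of
  `(1+11z+11z²+z³)(1-z)¹¹` vanishing — `(8, 8)` is the only exponent pair `ζᵃLᵇ` with this property:
  `11 = a + b - 5` from the split primes and `a = b` from the inert ones) and
  `φ*ₚ = (1+p⁻ˢ)(1-p⁻ˢ)⁵ = (1-p⁻ˢ)⁴(1-p^{-2s})` on `D` (so the printed majorant
  `∏_{p∣D}|1-p^{-4s}|` should read `∏_{p∣D}|1-p⁻ˢ|⁴|1-p^{-2s}|`; both are `O(1)` uniformly in `D`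
  for `σ > 0`, which is all the sketch uses — an immaterial slip, recorded, not repaired);
* the convergence half of "analytic for `σ > 1/2`": `∑ₚ ‖p⁻ˢ‖² < ∞` for `Re s > 1/2`
  (`summable_primes_norm_cpow_neg_sq`, from Mathlib's `Nat.Primes.summable_rpow`), hence any Euler
  product whose factors are within `C‖p⁻ˢ‖²` of `1` converges (`multipliable_of_norm_sub_one_le`,
  via `Complex.multipliable_one_add_of_summable`), in particular the unramified parts of `φ♭` and
  `φ*` (`multipliable_phiFlat_unramified`, `multipliable_phiStar_unramified`); the ramified parts
  are finite products of polynomials in `p⁻ˢ`. Holomorphy in `s` (locally uniform convergence) is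
  not formalised here — `TODO(holomorphy)`: the standard Weierstrass argument
  [Titchmarsh1986, §1.1].

The power sums `∑(m+1)ʲzᵐ`, `j = 1, 3, 4`, come from Mathlib's `∑ C(m+k,k)zᵐ = (1-z)^{-k-1}`
(`hasSum_choose_mul_geometric_of_norm_lt_one`) and `(m+1)³ = 6C(m+3,3) - 6C(m+2,2) + C(m+1,1)`,
`(m+1)⁴ = 24C(m+4,4) - 36C(m+3,3) + 14C(m+2,2) - C(m+1,1)` [folklore: Worpitzky / Eulerian numbers,
`1, 4, 1` and `1, 11, 11, 1`]; `j = 2` is `hasSum_natCast_add_one_sq_mul_pow` of the imported file.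

Why this is formalised (Landau–Siegel autopsy, `run/shared/lean/pub/pub-zhang`, ALT seat 1, repair
census row V17 and Edison families A11/A13): the cell's rows `T-ALT1a…i` (module
`Section3SubconvexInput`) take "the generating function of `ν²τ₂²` is `ζ⁸L⁸φ*` with `φ*` harmless on
`σ > 1/2`" and "that of `ν²τ₂` is `ζ⁴L⁴φ♭`" as their premises for `k = 8` and `k = 4`; this file
makes those premises kernel-checked at the level the source states them ("checking the cases").
All statements are classical; no statement about Theorems 1–2 of the source is made or implied.
-/

noncomputable section

open Complex Finset Filter Topology

namespace Literature.NumberTheory.LFunctions.Zhang2022.Section3EulerFactors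

/-! ### Elementary facts -/

/-- `1 - u ≠ 0` when `‖u‖ < 1`. [folklore] -/
private theorem one_sub_ne_zero' {u : ℂ} (hu : ‖u‖ < 1) : 1 - u ≠ 0 := by
  intro h0
  have : ‖u‖ = 1 := by rw [← sub_eq_zero.mp h0, norm_one]
  linarith

/-- `‖-u‖ < 1` when `‖u‖ < 1`. [folklore] -/
private theorem norm_neg_lt_one {u : ℂ} (hu : ‖u‖ < 1) : ‖-u‖ < 1 := by rwa [norm_neg]

/-- `1 + u ≠ 0` when `‖u‖ < 1`. [folklore] -/
private theorem one_add_ne_zero' {u : ℂ} (hu : ‖u‖ < 1) : 1 + u ≠ 0 := by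
  have h := one_sub_ne_zero' (norm_neg_lt_one hu)
  rwa [sub_neg_eq_add] at h

/-! ### `ν(pᵐ)` in the three cases `χ(p) = 1, -1, 0` -/

/-- `ν(pᵐ) = 1` for every `m` when `χ(p) = 0` (`p ∣ D`): `1 + 0 + ⋯ + 0 = 1`
(the case `χ(p) = 1`, `ν(pᵐ) = m + 1 = τ₂(pᵐ)`, is `geomPartialSum_one_left`). [folklore] -/
theorem geomPartialSum_zero_left (m : ℕ) : geomPartialSum 0 m = 1 := by
  induction m with
  | zero => simp
  | succ n ih =>
    rw [geomPartialSum_def, Finset.sum_range_succ, ← geomPartialSum_def, ih, pow_succ, mul_zero,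
      add_zero]

/-- `ν(pᵐ) = (1 + (-1)ᵐ)/2 ∈ {1, 0}` when `χ(p) = -1` (`p` inert). [folklore] -/
theorem geomPartialSum_neg_one_left (m : ℕ) : geomPartialSum (-1) m = (1 + (-1) ^ m) / 2 := by
  induction m with
  | zero => norm_num
  | succ n ih =>
    rw [geomPartialSum_def, Finset.sum_range_succ, ← geomPartialSum_def, ih, pow_succ]
    ring

/-- `ν(pᵐ)² = ν(pᵐ)` at an inert prime (the values are `1, 0, 1, 0, …`). [folklore] -/
theorem geomPartialSum_neg_one_sq (m : ℕ) : geomPartialSum (-1) m ^ 2 = geomPartialSum (-1) m := by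
  rw [geomPartialSum_neg_one_left]
  rcases neg_one_pow_eq_or ℂ m with h | h <;> rw [h] <;> norm_num

/-! ### Binomial identities and the power sums `∑ (m+1)ʲ zᵐ`, `j = 1, 3, 4` -/

/-- `2·C(m+2,2) = (m+1)(m+2)`. [folklore] -/
theorem two_mul_cast_choose_two (m : ℕ) :
    (2 : ℂ) * (((m + 2).choose 2 : ℕ) : ℂ) = (m + 1) * (m + 2) := by
  induction m with
  | zero => norm_num
  | succ n ih =>
    have h : (n + 1 + 2).choose 2 = (n + 2) + (n + 2).choose 2 := by
      rw [show n + 1 + 2 = (n + 2) + 1 by ring, Nat.choose_succ_succ', Nat.choose_one_right]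
    rw [h]
    push_cast at ih ⊢
    linear_combination ih

/-- `6·C(m+3,3) = (m+1)(m+2)(m+3)`. [folklore] -/
theorem six_mul_cast_choose_three (m : ℕ) :
    (6 : ℂ) * (((m + 3).choose 3 : ℕ) : ℂ) = (m + 1) * (m + 2) * (m + 3) := by
  induction m with
  | zero => norm_num
  | succ n ih =>
    have h : (n + 1 + 3).choose 3 = (n + 3).choose 2 + (n + 3).choose 3 := by
      rw [show n + 1 + 3 = (n + 3) + 1 by ring, Nat.choose_succ_succ']
    have h2 := two_mul_cast_choose_two (n + 1)
    rw [show n + 1 + 2 = n + 3 by ring] at h2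
    rw [h]
    push_cast at ih h2 ⊢
    linear_combination 3 * h2 + ih

/-- `24·C(m+4,4) = (m+1)(m+2)(m+3)(m+4)`. [folklore] -/
theorem twentyfour_mul_cast_choose_four (m : ℕ) :
    (24 : ℂ) * (((m + 4).choose 4 : ℕ) : ℂ) = (m + 1) * (m + 2) * (m + 3) * (m + 4) := by
  induction m with
  | zero => norm_num
  | succ n ih =>
    have h : (n + 1 + 4).choose 4 = (n + 4).choose 3 + (n + 4).choose 4 := by
      rw [show n + 1 + 4 = (n + 4) + 1 by ring, Nat.choose_succ_succ']
    have h3 := six_mul_cast_choose_three (n + 1)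
    rw [show n + 1 + 3 = n + 4 by ring] at h3
    rw [h]
    push_cast at ih h3 ⊢
    linear_combination 4 * h3 + ih

/-- `∑_{m≥0} (m+1) zᵐ = (1-z)⁻²` for `‖z‖ < 1` — the local series of `τ₂` at a prime, and of
`ν²τ₂` at a ramified prime. [folklore] -/
theorem hasSum_natCast_add_one_mul_pow {z : ℂ} (hz : ‖z‖ < 1) :
    HasSum (fun m : ℕ => ((m : ℂ) + 1) * z ^ m) (1 / (1 - z) ^ 2) := by
  have h1 : HasSum (fun n : ℕ => (((n + 1).choose 1 : ℕ) : ℂ) * z ^ n) (1 / (1 - z) ^ 2) :=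
    hasSum_choose_mul_geometric_of_norm_lt_one 1 hz
  convert h1 using 2 with m
  rw [Nat.choose_one_right]
  push_cast
  ring

/-- `∑_{m≥0} (m+1)³ zᵐ = (1 + 4z + z²)(1-z)⁻⁴` for `‖z‖ < 1` (Eulerian numbers `1, 4, 1`) — the
local series of `ν²τ₂` at a split prime. [folklore] -/
theorem hasSum_natCast_add_one_cube_mul_pow {z : ℂ} (hz : ‖z‖ < 1) :
    HasSum (fun m : ℕ => ((m : ℂ) + 1) ^ 3 * z ^ m) ((1 + 4 * z + z ^ 2) / (1 - z) ^ 4) := by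
  have h3 : HasSum (fun n : ℕ => (((n + 3).choose 3 : ℕ) : ℂ) * z ^ n) (1 / (1 - z) ^ 4) :=
    hasSum_choose_mul_geometric_of_norm_lt_one 3 hz
  have h2 : HasSum (fun n : ℕ => (((n + 2).choose 2 : ℕ) : ℂ) * z ^ n) (1 / (1 - z) ^ 3) :=
    hasSum_choose_mul_geometric_of_norm_lt_one 2 hz
  have h1 := hasSum_natCast_add_one_mul_pow hz
  have h := ((h3.mul_left 6).sub ((h2.mul_left 2).mul_left 3)).add h1
  have hz1 := one_sub_ne_zero' hz
  have key : HasSum (fun m : ℕ => ((m : ℂ) + 1) ^ 3 * z ^ m)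
      (6 * (1 / (1 - z) ^ 4) - 3 * (2 * (1 / (1 - z) ^ 3)) + 1 / (1 - z) ^ 2) :=
    h.congr_fun fun m => by
      have e3 := six_mul_cast_choose_three m
      have e2 := two_mul_cast_choose_two m
      linear_combination (-(z ^ m)) * e3 + (3 * z ^ m) * e2
  have hv : (6 * (1 / (1 - z) ^ 4) - 3 * (2 * (1 / (1 - z) ^ 3)) + 1 / (1 - z) ^ 2 : ℂ) =
      (1 + 4 * z + z ^ 2) / (1 - z) ^ 4 := by
    field_simp
    ring
  rwa [hv] at key

/-- `∑_{m≥0} (m+1)⁴ zᵐ = (1 + 11z + 11z² + z³)(1-z)⁻⁵` for `‖z‖ < 1` (Eulerian numbers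
`1, 11, 11, 1`) — the local series of `ν²τ₂²` at a split prime. [folklore] -/
theorem hasSum_natCast_add_one_pow_four_mul_pow {z : ℂ} (hz : ‖z‖ < 1) :
    HasSum (fun m : ℕ => ((m : ℂ) + 1) ^ 4 * z ^ m)
      ((1 + 11 * z + 11 * z ^ 2 + z ^ 3) / (1 - z) ^ 5) := by
  have h4 : HasSum (fun n : ℕ => (((n + 4).choose 4 : ℕ) : ℂ) * z ^ n) (1 / (1 - z) ^ 5) :=
    hasSum_choose_mul_geometric_of_norm_lt_one 4 hz
  have h3 : HasSum (fun n : ℕ => (((n + 3).choose 3 : ℕ) : ℂ) * z ^ n) (1 / (1 - z) ^ 4) :=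
    hasSum_choose_mul_geometric_of_norm_lt_one 3 hz
  have h2 : HasSum (fun n : ℕ => (((n + 2).choose 2 : ℕ) : ℂ) * z ^ n) (1 / (1 - z) ^ 3) :=
    hasSum_choose_mul_geometric_of_norm_lt_one 2 hz
  have h1 := hasSum_natCast_add_one_mul_pow hz
  have h := (((h4.mul_left 24).sub ((h3.mul_left 6).mul_left 6)).add
    ((h2.mul_left 2).mul_left 7)).sub h1
  have hz1 := one_sub_ne_zero' hz
  have key : HasSum (fun m : ℕ => ((m : ℂ) + 1) ^ 4 * z ^ m)
      (24 * (1 / (1 - z) ^ 5) - 6 * (6 * (1 / (1 - z) ^ 4)) + 7 * (2 * (1 / (1 - z) ^ 3))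
        - 1 / (1 - z) ^ 2) :=
    h.congr_fun fun m => by
      have e4 := twentyfour_mul_cast_choose_four m
      have e3 := six_mul_cast_choose_three m
      have e2 := two_mul_cast_choose_two m
      linear_combination (-(z ^ m)) * e4 + (6 * z ^ m) * e3 + (-(7 * z ^ m)) * e2
  have hv : (24 * (1 / (1 - z) ^ 5) - 6 * (6 * (1 / (1 - z) ^ 4)) + 7 * (2 * (1 / (1 - z) ^ 3))
        - 1 / (1 - z) ^ 2 : ℂ) = (1 + 11 * z + 11 * z ^ 2 + z ^ 3) / (1 - z) ^ 5 := by
    field_simp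
    ring
  rwa [hv] at key

/-! ### Lemma 3.1: the local factors of `∑ ν(n)² n⁻ˢ` against `ζ(s)²L(s,χ)²`

In each case the sum is displayed as `φₚ · [ζ²L²]ₚ` with `[ζ²L²]ₚ = (1-z)⁻²(1-wz)⁻²`, `w = χ(p)`,
`z = p⁻ˢ`. -/

/-- Split prime (`χ(p) = 1`): `∑ₘ ν(pᵐ)² zᵐ = (1 - z²)·(1-z)⁻⁴`, i.e. `φₚ = 1 - p^{-2s}`
("`φₚ(s) = 1 + O(p^{-2σ})` if `p ∤ D`"). [cite: Zhang2022LandauSiegel, Lemma 3.1 proof] -/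
theorem hasSum_nu_sq_split {z : ℂ} (hz : ‖z‖ < 1) :
    HasSum (fun m : ℕ => geomPartialSum 1 m ^ 2 * z ^ m) ((1 - z ^ 2) / (1 - z) ^ 4) := by
  have h := hasSum_natCast_add_one_sq_mul_pow hz
  have hz1 := one_sub_ne_zero' hz
  have key : HasSum (fun m : ℕ => geomPartialSum 1 m ^ 2 * z ^ m) ((1 + z) / (1 - z) ^ 3) :=
    h.congr_fun fun m => by
      rw [geomPartialSum_one_left]
  have hv : (1 + z) / (1 - z) ^ 3 = (1 - z ^ 2) / (1 - z) ^ 4 := by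
    rw [div_eq_div_iff (pow_ne_zero _ hz1) (pow_ne_zero _ hz1)]
    ring
  rwa [hv] at key

/-- Inert prime (`χ(p) = -1`): `∑ₘ ν(pᵐ)² zᵐ = ∑_{m even} zᵐ = (1 - z²)·(1-z)⁻²(1+z)⁻²`, i.e.
`φₚ = 1 - p^{-2s}` again. [cite: Zhang2022LandauSiegel, Lemma 3.1 proof] -/
theorem hasSum_nu_sq_inert {z : ℂ} (hz : ‖z‖ < 1) :
    HasSum (fun m : ℕ => geomPartialSum (-1) m ^ 2 * z ^ m)
      ((1 - z ^ 2) / ((1 - z) ^ 2 * (1 + z) ^ 2)) := by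
  have hp := hasSum_geometric_of_norm_lt_one hz
  have hn := hasSum_geometric_of_norm_lt_one (norm_neg_lt_one hz)
  have h := (hp.add hn).div_const 2
  have hz1 := one_sub_ne_zero' hz
  have hz2 := one_add_ne_zero' hz
  have key : HasSum (fun m : ℕ => geomPartialSum (-1) m ^ 2 * z ^ m)
      (((1 - z)⁻¹ + (1 - -z)⁻¹) / 2) :=
    h.congr_fun fun m => by
      rw [geomPartialSum_neg_one_sq, geomPartialSum_neg_one_left, neg_pow z m]
      ring
  have hv : ((1 - z)⁻¹ + (1 - -z)⁻¹) / 2 = (1 - z ^ 2) / ((1 - z) ^ 2 * (1 + z) ^ 2) := by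
    rw [sub_neg_eq_add]
    field_simp
    ring
  rwa [hv] at key

/-- Ramified prime (`χ(p) = 0`): `∑ₘ ν(pᵐ)² zᵐ = ∑ₘ zᵐ = (1 - z)·(1-z)⁻²`, i.e. `φₚ = 1 - p⁻ˢ`
("`φₚ(s) = (1 - p⁻ˢ)(1 + O(p^{-2σ}))` if `p ∣ D`", here with no error term at all).
[cite: Zhang2022LandauSiegel, Lemma 3.1 proof, (3.3)] -/
theorem hasSum_nu_sq_ramified {z : ℂ} (hz : ‖z‖ < 1) :
    HasSum (fun m : ℕ => geomPartialSum 0 m ^ 2 * z ^ m) ((1 - z) / (1 - z) ^ 2) := by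
  have h := hasSum_geometric_of_norm_lt_one hz
  have hz1 := one_sub_ne_zero' hz
  have key : HasSum (fun m : ℕ => geomPartialSum 0 m ^ 2 * z ^ m) (1 - z)⁻¹ :=
    h.congr_fun fun m => by
      rw [geomPartialSum_zero_left]
      ring
  have hv : (1 - z)⁻¹ = (1 - z) / (1 - z) ^ 2 := by
    rw [inv_eq_one_div, div_eq_div_iff hz1 (pow_ne_zero _ hz1)]
    ring
  rwa [hv] at key

/-! ### The four-factor variant (`ν²τ₂`, the cell's Lemma 3.2♭ / family A11): local factors against
`ζ(s)⁴L(s,χ)⁴`, `[ζ⁴L⁴]ₚ = (1-z)⁻⁴(1-wz)⁻⁴` -/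

/-- Split prime: `∑ₘ ν(pᵐ)²τ₂(pᵐ) zᵐ = ∑(m+1)³zᵐ = (1 - 9z² + 16z³ - 9z⁴ + z⁶)·(1-z)⁻⁸`,
i.e. `φ♭ₚ = (1+4z+z²)(1-z)⁴ = 1 - 9z² + 16z³ - 9z⁴ + z⁶`. [folklore] -/
theorem hasSum_nu_sq_tau_split {z : ℂ} (hz : ‖z‖ < 1) :
    HasSum (fun m : ℕ => geomPartialSum 1 m ^ 2 * ((m : ℂ) + 1) * z ^ m)
      ((1 - 9 * z ^ 2 + 16 * z ^ 3 - 9 * z ^ 4 + z ^ 6) / (1 - z) ^ 8) := by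
  have h := hasSum_natCast_add_one_cube_mul_pow hz
  have hz1 := one_sub_ne_zero' hz
  have key : HasSum (fun m : ℕ => geomPartialSum 1 m ^ 2 * ((m : ℂ) + 1) * z ^ m)
      ((1 + 4 * z + z ^ 2) / (1 - z) ^ 4) :=
    h.congr_fun fun m => by
      rw [geomPartialSum_one_left]
      ring
  have hv : (1 + 4 * z + z ^ 2) / (1 - z) ^ 4 =
      (1 - 9 * z ^ 2 + 16 * z ^ 3 - 9 * z ^ 4 + z ^ 6) / (1 - z) ^ 8 := by
    rw [div_eq_div_iff (pow_ne_zero _ hz1) (pow_ne_zero _ hz1)]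
    ring
  rwa [hv] at key

/-- Inert prime: `∑ₘ ν(pᵐ)²τ₂(pᵐ) zᵐ = ∑_{m even}(m+1)zᵐ = (1+z²)(1-z²)⁻²
= (1 - z² - z⁴ + z⁶)·(1-z)⁻⁴(1+z)⁻⁴`, i.e. `φ♭ₚ = (1+z²)(1-z²)² = 1 - z² - z⁴ + z⁶`. [folklore] -/
theorem hasSum_nu_sq_tau_inert {z : ℂ} (hz : ‖z‖ < 1) :
    HasSum (fun m : ℕ => geomPartialSum (-1) m ^ 2 * ((m : ℂ) + 1) * z ^ m)
      ((1 - z ^ 2 - z ^ 4 + z ^ 6) / ((1 - z) ^ 4 * (1 + z) ^ 4)) := by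
  have hp := hasSum_natCast_add_one_mul_pow hz
  have hn := hasSum_natCast_add_one_mul_pow (norm_neg_lt_one hz)
  have h := (hp.add hn).div_const 2
  have hz1 := one_sub_ne_zero' hz
  have hz2 := one_add_ne_zero' hz
  have key : HasSum (fun m : ℕ => geomPartialSum (-1) m ^ 2 * ((m : ℂ) + 1) * z ^ m)
      ((1 / (1 - z) ^ 2 + 1 / (1 - -z) ^ 2) / 2) :=
    h.congr_fun fun m => by
      rw [geomPartialSum_neg_one_sq, geomPartialSum_neg_one_left, neg_pow z m]
      ring
  have hv : (1 / (1 - z) ^ 2 + 1 / (1 - -z) ^ 2) / 2 =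
      (1 - z ^ 2 - z ^ 4 + z ^ 6) / ((1 - z) ^ 4 * (1 + z) ^ 4) := by
    rw [sub_neg_eq_add]
    field_simp
    ring
  rwa [hv] at key

/-- Ramified prime: `∑ₘ ν(pᵐ)²τ₂(pᵐ) zᵐ = ∑(m+1)zᵐ = (1-z)²·(1-z)⁻⁴`, i.e. `φ♭ₚ = (1 - p⁻ˢ)²`.
[folklore] -/
theorem hasSum_nu_sq_tau_ramified {z : ℂ} (hz : ‖z‖ < 1) :
    HasSum (fun m : ℕ => geomPartialSum 0 m ^ 2 * ((m : ℂ) + 1) * z ^ m)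
      ((1 - z) ^ 2 / (1 - z) ^ 4) := by
  have h := hasSum_natCast_add_one_mul_pow hz
  have hz1 := one_sub_ne_zero' hz
  have key : HasSum (fun m : ℕ => geomPartialSum 0 m ^ 2 * ((m : ℂ) + 1) * z ^ m)
      (1 / (1 - z) ^ 2) :=
    h.congr_fun fun m => by
      rw [geomPartialSum_zero_left]
      ring
  have hv : 1 / (1 - z) ^ 2 = (1 - z) ^ 2 / (1 - z) ^ 4 := by
    rw [div_eq_div_iff (pow_ne_zero _ hz1) (pow_ne_zero _ hz1)]
    ring
  rwa [hv] at key

/-! ### Printed Lemma 3.2 (`ν²τ₂²`): local factors against `ζ(s)⁸L(s,χ)⁸`,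
`[ζ⁸L⁸]ₚ = (1-z)⁻⁸(1-wz)⁻⁸` -/

/-- Split prime: `∑ₘ ν(pᵐ)²τ₂(pᵐ)² zᵐ = ∑(m+1)⁴zᵐ = [(1+11z+11z²+z³)(1-z)¹¹]·(1-z)⁻¹⁶`,
i.e. `φ*ₚ = (1+11z+11z²+z³)(1-z)¹¹`. [cite: Zhang2022LandauSiegel, Lemma 3.2 sketch] -/
theorem hasSum_nu_sq_tau_sq_split {z : ℂ} (hz : ‖z‖ < 1) :
    HasSum (fun m : ℕ => geomPartialSum 1 m ^ 2 * ((m : ℂ) + 1) ^ 2 * z ^ m)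
      ((1 + 11 * z + 11 * z ^ 2 + z ^ 3) * (1 - z) ^ 11 / (1 - z) ^ 16) := by
  have h := hasSum_natCast_add_one_pow_four_mul_pow hz
  have hz1 := one_sub_ne_zero' hz
  have key : HasSum (fun m : ℕ => geomPartialSum 1 m ^ 2 * ((m : ℂ) + 1) ^ 2 * z ^ m)
      ((1 + 11 * z + 11 * z ^ 2 + z ^ 3) / (1 - z) ^ 5) :=
    h.congr_fun fun m => by
      rw [geomPartialSum_one_left]
      ring
  have hv : (1 + 11 * z + 11 * z ^ 2 + z ^ 3) / (1 - z) ^ 5 =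
      (1 + 11 * z + 11 * z ^ 2 + z ^ 3) * (1 - z) ^ 11 / (1 - z) ^ 16 := by
    rw [div_eq_div_iff (pow_ne_zero _ hz1) (pow_ne_zero _ hz1)]
    ring
  rwa [hv] at key

/-- Inert prime: `∑ₘ ν(pᵐ)²τ₂(pᵐ)² zᵐ = ∑_{m even}(m+1)²zᵐ = (1+6z²+z⁴)(1-z²)⁻³
= [(1+6z²+z⁴)(1-z²)⁵]·(1-z)⁻⁸(1+z)⁻⁸`, i.e. `φ*ₚ = (1+6z²+z⁴)(1-z²)⁵`.
[cite: Zhang2022LandauSiegel, Lemma 3.2 sketch] -/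
theorem hasSum_nu_sq_tau_sq_inert {z : ℂ} (hz : ‖z‖ < 1) :
    HasSum (fun m : ℕ => geomPartialSum (-1) m ^ 2 * ((m : ℂ) + 1) ^ 2 * z ^ m)
      ((1 + 6 * z ^ 2 + z ^ 4) * (1 - z ^ 2) ^ 5 / ((1 - z) ^ 8 * (1 + z) ^ 8)) := by
  have hp := hasSum_natCast_add_one_sq_mul_pow hz
  have hn := hasSum_natCast_add_one_sq_mul_pow (norm_neg_lt_one hz)
  have h := (hp.add hn).div_const 2
  have hz1 := one_sub_ne_zero' hz
  have hz2 := one_add_ne_zero' hz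
  have key : HasSum (fun m : ℕ => geomPartialSum (-1) m ^ 2 * ((m : ℂ) + 1) ^ 2 * z ^ m)
      (((1 + z) / (1 - z) ^ 3 + (1 + -z) / (1 - -z) ^ 3) / 2) :=
    h.congr_fun fun m => by
      rw [geomPartialSum_neg_one_sq, geomPartialSum_neg_one_left, neg_pow z m]
      ring
  have hv : ((1 + z) / (1 - z) ^ 3 + (1 + -z) / (1 - -z) ^ 3) / 2 =
      (1 + 6 * z ^ 2 + z ^ 4) * (1 - z ^ 2) ^ 5 / ((1 - z) ^ 8 * (1 + z) ^ 8) := by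
    rw [sub_neg_eq_add, ← sub_eq_add_neg]
    field_simp
    ring
  rwa [hv] at key

/-- Ramified prime: `∑ₘ ν(pᵐ)²τ₂(pᵐ)² zᵐ = ∑(m+1)²zᵐ = [(1+z)(1-z)⁵]·(1-z)⁻⁸`, i.e.
`φ*ₚ = (1+p⁻ˢ)(1-p⁻ˢ)⁵ = (1-p⁻ˢ)⁴(1-p^{-2s})` (the printed majorant has `|1-p^{-4s}|` here).
[cite: Zhang2022LandauSiegel, Lemma 3.2 sketch] -/
theorem hasSum_nu_sq_tau_sq_ramified {z : ℂ} (hz : ‖z‖ < 1) :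
    HasSum (fun m : ℕ => geomPartialSum 0 m ^ 2 * ((m : ℂ) + 1) ^ 2 * z ^ m)
      ((1 + z) * (1 - z) ^ 5 / (1 - z) ^ 8) := by
  have h := hasSum_natCast_add_one_sq_mul_pow hz
  have hz1 := one_sub_ne_zero' hz
  have key : HasSum (fun m : ℕ => geomPartialSum 0 m ^ 2 * ((m : ℂ) + 1) ^ 2 * z ^ m)
      ((1 + z) / (1 - z) ^ 3) :=
    h.congr_fun fun m => by
      rw [geomPartialSum_zero_left]
      ring
  have hv : (1 + z) / (1 - z) ^ 3 = (1 + z) * (1 - z) ^ 5 / (1 - z) ^ 8 := by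
    rw [div_eq_div_iff (pow_ne_zero _ hz1) (pow_ne_zero _ hz1)]
    ring
  rwa [hv] at key

/-- The ramified factor in the two shapes: `(1+z)(1-z)⁵ = (1-z)⁴(1-z²)`. [folklore] -/
theorem phiStar_ramified_eq (z : ℂ) : (1 + z) * (1 - z) ^ 5 = (1 - z) ^ 4 * (1 - z ^ 2) := by
  ring

/-! ### `φₚ = 1 + O(p^{-2σ})` off `D`: the expansions and explicit constants -/

/-- `‖∑ᵢ cᵢ zⁱ‖ ≤ ∑ᵢ ‖cᵢ‖` for `‖z‖ ≤ 1` (a polynomial with listed coefficients). [folklore] -/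
theorem norm_sum_fin_mul_pow_le {z : ℂ} (hz : ‖z‖ ≤ 1) {n : ℕ} (c : Fin n → ℂ) :
    ‖∑ i : Fin n, c i * z ^ (i : ℕ)‖ ≤ ∑ i : Fin n, ‖c i‖ := by
  refine (norm_sum_le _ _).trans (sum_le_sum fun i _ => ?_)
  rw [norm_mul, norm_pow]
  exact mul_le_of_le_one_right (norm_nonneg _) (pow_le_one₀ (norm_nonneg _) hz)

/-- Lemma 3.1, off `D`: `φₚ - 1 = -z²`, so `‖φₚ - 1‖ = ‖z‖²` (`= p^{-2σ}`). [folklore] -/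
theorem norm_phi_unramified_sub_one (z : ℂ) : ‖(1 - z ^ 2) - 1‖ = ‖z‖ ^ 2 := by
  rw [show (1 - z ^ 2) - 1 = -(z ^ 2) by ring, norm_neg, norm_pow]

/-- `φ♭` at a split prime: `1 - 9z² + 16z³ - 9z⁴ + z⁶ = 1 + z²(-9 + 16z - 9z² + z⁴)`. [folklore] -/
theorem phiFlat_split_expand (z : ℂ) :
    1 - 9 * z ^ 2 + 16 * z ^ 3 - 9 * z ^ 4 + z ^ 6 =
      1 + z ^ 2 * (-9 + 16 * z - 9 * z ^ 2 + z ^ 4) := by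
  ring

/-- `φ♭` at a split prime: `‖φ♭ₚ - 1‖ ≤ 35‖z‖²` for `‖z‖ ≤ 1`. [folklore] -/
theorem norm_phiFlat_split_sub_one_le {z : ℂ} (hz : ‖z‖ ≤ 1) :
    ‖(1 - 9 * z ^ 2 + 16 * z ^ 3 - 9 * z ^ 4 + z ^ 6) - 1‖ ≤ 35 * ‖z‖ ^ 2 := by
  have hc : (-9 + 16 * z - 9 * z ^ 2 + z ^ 4 : ℂ) =
      ∑ i : Fin 5, (![-9, 16, -9, 0, 1] : Fin 5 → ℂ) i * z ^ (i : ℕ) := by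
    simp [Fin.sum_univ_succ]
    ring
  have hn : ∑ i : Fin 5, ‖(![-9, 16, -9, 0, 1] : Fin 5 → ℂ) i‖ = 35 := by
    simp [Fin.sum_univ_succ]
    norm_num
  have hB : ‖(-9 + 16 * z - 9 * z ^ 2 + z ^ 4 : ℂ)‖ ≤ 35 := by
    rw [hc, ← hn]
    exact norm_sum_fin_mul_pow_le hz _
  rw [phiFlat_split_expand, add_sub_cancel_left, norm_mul, norm_pow, mul_comm]
  exact mul_le_mul_of_nonneg_right hB (sq_nonneg _)

/-- `φ♭` at an inert prime: `1 - z² - z⁴ + z⁶ = 1 + z²(-1 - z² + z⁴)`. [folklore] -/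
theorem phiFlat_inert_expand (z : ℂ) :
    1 - z ^ 2 - z ^ 4 + z ^ 6 = 1 + z ^ 2 * (-1 - z ^ 2 + z ^ 4) := by
  ring

/-- `φ♭` at an inert prime: `‖φ♭ₚ - 1‖ ≤ 3‖z‖²` for `‖z‖ ≤ 1`. [folklore] -/
theorem norm_phiFlat_inert_sub_one_le {z : ℂ} (hz : ‖z‖ ≤ 1) :
    ‖(1 - z ^ 2 - z ^ 4 + z ^ 6) - 1‖ ≤ 3 * ‖z‖ ^ 2 := by
  have hc : (-1 - z ^ 2 + z ^ 4 : ℂ) =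
      ∑ i : Fin 5, (![-1, 0, -1, 0, 1] : Fin 5 → ℂ) i * z ^ (i : ℕ) := by
    simp [Fin.sum_univ_succ]
    ring
  have hn : ∑ i : Fin 5, ‖(![-1, 0, -1, 0, 1] : Fin 5 → ℂ) i‖ = 3 := by
    simp [Fin.sum_univ_succ]
    norm_num
  have hB : ‖(-1 - z ^ 2 + z ^ 4 : ℂ)‖ ≤ 3 := by
    rw [hc, ← hn]
    exact norm_sum_fin_mul_pow_le hz _
  rw [phiFlat_inert_expand, add_sub_cancel_left, norm_mul, norm_pow, mul_comm]
  exact mul_le_mul_of_nonneg_right hB (sq_nonneg _)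

/-- `φ*` at a split prime: `(1+11z+11z²+z³)(1-z)¹¹ = 1 + z²·Q(z)` — NO linear term — with
`Q(z) = -55 + 320z - 891z² + 1408z³ - 1155z⁴ + 1155z⁶ - 1408z⁷ + 891z⁸ - 320z⁹ + 55z¹⁰ - z¹²`.
[folklore] -/
theorem phiStar_split_expand (z : ℂ) :
    (1 + 11 * z + 11 * z ^ 2 + z ^ 3) * (1 - z) ^ 11 =
      1 + z ^ 2 * (-55 + 320 * z - 891 * z ^ 2 + 1408 * z ^ 3 - 1155 * z ^ 4 + 1155 * z ^ 6
        - 1408 * z ^ 7 + 891 * z ^ 8 - 320 * z ^ 9 + 55 * z ^ 10 - z ^ 12) := by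
  ring

/-- `φ*` at a split prime: `‖φ*ₚ - 1‖ ≤ 7659‖z‖²` for `‖z‖ ≤ 1` (`7659 = ∑|coefficients of Q|`).
[folklore] -/
theorem norm_phiStar_split_sub_one_le {z : ℂ} (hz : ‖z‖ ≤ 1) :
    ‖(1 + 11 * z + 11 * z ^ 2 + z ^ 3) * (1 - z) ^ 11 - 1‖ ≤ 7659 * ‖z‖ ^ 2 := by
  have hc : (-55 + 320 * z - 891 * z ^ 2 + 1408 * z ^ 3 - 1155 * z ^ 4 + 1155 * z ^ 6
        - 1408 * z ^ 7 + 891 * z ^ 8 - 320 * z ^ 9 + 55 * z ^ 10 - z ^ 12 : ℂ) =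
      ∑ i : Fin 13, (![-55, 320, -891, 1408, -1155, 0, 1155, -1408, 891, -320, 55, 0, -1] :
        Fin 13 → ℂ) i * z ^ (i : ℕ) := by
    simp [Fin.sum_univ_succ]
    ring
  have hn : ∑ i : Fin 13, ‖(![-55, 320, -891, 1408, -1155, 0, 1155, -1408, 891, -320, 55, 0, -1] :
      Fin 13 → ℂ) i‖ = 7659 := by
    simp [Fin.sum_univ_succ]
    norm_num
  have hB : ‖(-55 + 320 * z - 891 * z ^ 2 + 1408 * z ^ 3 - 1155 * z ^ 4 + 1155 * z ^ 6
        - 1408 * z ^ 7 + 891 * z ^ 8 - 320 * z ^ 9 + 55 * z ^ 10 - z ^ 12 : ℂ)‖ ≤ 7659 := by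
    rw [hc, ← hn]
    exact norm_sum_fin_mul_pow_le hz _
  rw [phiStar_split_expand, add_sub_cancel_left, norm_mul, norm_pow, mul_comm]
  exact mul_le_mul_of_nonneg_right hB (sq_nonneg _)

/-- `φ*` at an inert prime: `(1+6z²+z⁴)(1-z²)⁵ = 1 + z²·(1 - 19z² + 45z⁴ - 45z⁶ + 19z⁸ - z¹⁰ - z¹²)`
(the `z²`-coefficient is `+1`, not `0`: still `1 + O(p^{-2σ})`). [folklore] -/
theorem phiStar_inert_expand (z : ℂ) :
    (1 + 6 * z ^ 2 + z ^ 4) * (1 - z ^ 2) ^ 5 =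
      1 + z ^ 2 * (1 - 19 * z ^ 2 + 45 * z ^ 4 - 45 * z ^ 6 + 19 * z ^ 8 - z ^ 10 - z ^ 12) := by
  ring

/-- `φ*` at an inert prime: `‖φ*ₚ - 1‖ ≤ 131‖z‖²` for `‖z‖ ≤ 1`. [folklore] -/
theorem norm_phiStar_inert_sub_one_le {z : ℂ} (hz : ‖z‖ ≤ 1) :
    ‖(1 + 6 * z ^ 2 + z ^ 4) * (1 - z ^ 2) ^ 5 - 1‖ ≤ 131 * ‖z‖ ^ 2 := by
  have hc : (1 - 19 * z ^ 2 + 45 * z ^ 4 - 45 * z ^ 6 + 19 * z ^ 8 - z ^ 10 - z ^ 12 : ℂ) =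
      ∑ i : Fin 13, (![1, 0, -19, 0, 45, 0, -45, 0, 19, 0, -1, 0, -1] : Fin 13 → ℂ) i
        * z ^ (i : ℕ) := by
    simp [Fin.sum_univ_succ]
    ring
  have hn : ∑ i : Fin 13, ‖(![1, 0, -19, 0, 45, 0, -45, 0, 19, 0, -1, 0, -1] : Fin 13 → ℂ) i‖
      = 131 := by
    simp [Fin.sum_univ_succ]
    norm_num
  have hB : ‖(1 - 19 * z ^ 2 + 45 * z ^ 4 - 45 * z ^ 6 + 19 * z ^ 8 - z ^ 10 - z ^ 12 : ℂ)‖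
      ≤ 131 := by
    rw [hc, ← hn]
    exact norm_sum_fin_mul_pow_le hz _
  rw [phiStar_inert_expand, add_sub_cancel_left, norm_mul, norm_pow, mul_comm]
  exact mul_le_mul_of_nonneg_right hB (sq_nonneg _)

/-! ### Convergence of the unramified Euler products for `Re s > 1/2` -/

/-- For `Re s > 1/2`: `∑ₚ ‖p⁻ˢ‖² = ∑ₚ p^{-2σ} < ∞`. [folklore] -/
theorem summable_primes_norm_cpow_neg_sq {s : ℂ} (hs : 1 / 2 < s.re) :
    Summable (fun p : Nat.Primes => ‖((p : ℕ) : ℂ) ^ (-s)‖ ^ 2) := by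
  have h := Nat.Primes.summable_rpow.mpr (show -2 * s.re < -1 by linarith)
  refine h.congr fun p => ?_
  rw [norm_natCast_cpow_of_pos p.prop.pos, neg_re, sq,
    ← Real.rpow_add (by exact_mod_cast p.prop.pos)]
  ring_nf

/-- `‖p⁻ˢ‖ < 1` for a prime `p` and `Re s > 0`. [folklore] -/
theorem norm_prime_cpow_neg_lt_one {s : ℂ} (hs : 0 < s.re) (p : Nat.Primes) :
    ‖((p : ℕ) : ℂ) ^ (-s)‖ < 1 := by
  rw [norm_natCast_cpow_of_pos p.prop.pos, neg_re]
  exact Real.rpow_lt_one_of_one_lt_of_neg (by exact_mod_cast p.prop.one_lt) (by linarith)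

/-- An Euler product over the primes whose factors are within `C·‖p⁻ˢ‖²` of `1` converges for
`Re s > 1/2` (Mathlib: `Complex.multipliable_one_add_of_summable`). [folklore] -/
theorem multipliable_of_norm_sub_one_le {s : ℂ} (hs : 1 / 2 < s.re) {f : Nat.Primes → ℂ} {C : ℝ}
    (hf : ∀ p, ‖f p - 1‖ ≤ C * ‖((p : ℕ) : ℂ) ^ (-s)‖ ^ 2) : Multipliable f := by
  have hsum : Summable (fun p => f p - 1) :=
    Summable.of_norm_bounded ((summable_primes_norm_cpow_neg_sq hs).mul_left C) hf
  have h := Complex.multipliable_one_add_of_summable hsum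
  simpa using h

/-- The unramified part of the Euler product of `φ♭ = ζ⁻⁴L⁻⁴∑ν²τ₂n⁻ˢ` converges for `Re s > 1/2`:
for ANY assignment `w p ∈ {1, -1, 0}` of splitting types (for `χ` mod `D`: `w p = χ(p)`), the
product over `p` of `φ♭ₚ(p⁻ˢ)` (split / inert factor as computed above, factor `1` at the finitely
many ramified primes, whose true factors `(1-p⁻ˢ)²` form a separate finite product) is
`Multipliable`.
[folklore] -/
theorem multipliable_phiFlat_unramified {s : ℂ} (hs : 1 / 2 < s.re) (w : Nat.Primes → ℂ) :
    Multipliable (fun p : Nat.Primes =>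
      if w p = 1 then 1 - 9 * (((p : ℕ) : ℂ) ^ (-s)) ^ 2 + 16 * (((p : ℕ) : ℂ) ^ (-s)) ^ 3
          - 9 * (((p : ℕ) : ℂ) ^ (-s)) ^ 4 + (((p : ℕ) : ℂ) ^ (-s)) ^ 6
      else if w p = -1 then 1 - (((p : ℕ) : ℂ) ^ (-s)) ^ 2 - (((p : ℕ) : ℂ) ^ (-s)) ^ 4
          + (((p : ℕ) : ℂ) ^ (-s)) ^ 6
      else 1) := by
  refine multipliable_of_norm_sub_one_le hs (C := 35) fun p => ?_
  have hz : ‖((p : ℕ) : ℂ) ^ (-s)‖ ≤ 1 := (norm_prime_cpow_neg_lt_one (by linarith) p).le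
  split_ifs with h1 h2
  · exact norm_phiFlat_split_sub_one_le hz
  · exact (norm_phiFlat_inert_sub_one_le hz).trans (by gcongr; norm_num)
  · simp only [sub_self, norm_zero]
    positivity

/-- The unramified part of the Euler product of `φ* = ζ⁻⁸L⁻⁸∑ν²τ₂²n⁻ˢ` (printed Lemma 3.2:
"`φ*(s)` … is analytic for `σ > 1/2`") converges for `Re s > 1/2`, in the same sense.
[cite: Zhang2022LandauSiegel, Lemma 3.2 sketch] -/
theorem multipliable_phiStar_unramified {s : ℂ} (hs : 1 / 2 < s.re) (w : Nat.Primes → ℂ) :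
    Multipliable (fun p : Nat.Primes =>
      if w p = 1 then (1 + 11 * (((p : ℕ) : ℂ) ^ (-s)) + 11 * (((p : ℕ) : ℂ) ^ (-s)) ^ 2
          + (((p : ℕ) : ℂ) ^ (-s)) ^ 3) * (1 - ((p : ℕ) : ℂ) ^ (-s)) ^ 11
      else if w p = -1 then (1 + 6 * (((p : ℕ) : ℂ) ^ (-s)) ^ 2 + (((p : ℕ) : ℂ) ^ (-s)) ^ 4)
          * (1 - (((p : ℕ) : ℂ) ^ (-s)) ^ 2) ^ 5
      else 1) := by
  refine multipliable_of_norm_sub_one_le hs (C := 7659) fun p => ?_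
  have hz : ‖((p : ℕ) : ℂ) ^ (-s)‖ ≤ 1 := (norm_prime_cpow_neg_lt_one (by linarith) p).le
  split_ifs with h1 h2
  · exact norm_phiStar_split_sub_one_le hz
  · exact (norm_phiStar_inert_sub_one_le hz).trans (by gcongr; norm_num)
  · simp only [sub_self, norm_zero]
    positivity

end Literature.NumberTheory.LFunctions.Zhang2022.Section3EulerFactors
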